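import Literature.NumberTheory.Automorphic.UnitaryThreeBorelCosetCountJZero
import Literature.NumberTheory.LocalFields.UnramifiedQuadraticNormResidueShiftPairs
import HarnessLib

/-!
# Flicker's Prop. 13, cases (c)∕(e), AS A COSET COUNT over the CORE-0 criterion: `#{y ∈ P_H ⧸ (P_H ∩ H^K_m) : y⁻¹ τ₀ y ∈ H^K_m} = F · q^{m−1}(q+1) · (q+1)q^{2m−j−1}`
(Flicker (1998), *Elementary proof of the fundamental lemma for a unitary group*, Prop. 13 p. 93, cases (c) and (e); Prop. 8 p. 84)

Topic `NumberTheory/Automorphic` (road «D-N7-inert», MAP v3 (F8) PROP. 13, LAYER B (13-ii) COUNT-0); namespace `Literature.NumberTheory.Automorphic.UnitaryGroup`.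
THEOREMS ONLY: no definition, no named fact, no instance, no notation, no `sorry`; kernel lane.  Pen F0P3b-p01 (g6) under A-p03 (g24) pen 1 (LEAD F0P3a-plan (g9) T8-70
(C); census `F0/P3/F0P3b-p01/g6/CENSUS-F8-Prop13-CountZero-X1.F0P3bp01g6.md`).  Sequel of ★ `UnitaryThreeBorelCosetCountJZero` (cases (b)∕(d)); same TEMPLATE (★ A-p03
`natCard_cosets_regime_four`).  HC_CM is proved only modulo the 2 remaining named inputs (hLiu418, h413) until rung 0 closes; this file pays no letter by itself.

THE MATHEMATICS [Flicker1998UnitaryFL, Prop. 13 p. 93, case (c)].  On the `θ̄ = 0 = j` stratum, in the regime of the printed cases (c)∕(e), CORE-0 (p04 (g12),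
`conditions_iff_norm_sub_le_of_near`) reads the conjugation condition for `p = p(u, x, w) ∈ P_H` as **`|N(z) − (e² − 1)| ≤ |ϖ^j|`, `z = (uσu)⁻¹ + e + x`**, `e` the
`σ`-fixed part of `(A−b)∕B` (integral), `j = 2m − N`, with `e² − 1 = c₀` of EVEN order `2ℓ = M − N < j`.  Taking that criterion as the BINDER `hce` (values-abstract) and
writing `e² − 1 = ϖ^{2ℓ}γ` (`γ` a `σ`-fixed unit), this file COUNTS the good cosets through B-p04's `ρ_m` (fibres of constant size `F`, binder `hfib`; `F = q^m` by (H2)):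
they are `F` times the pairs counted by ★ `natCard_pairs_norm_congr_shift` (FILE 8 of `UnramifiedQuadraticNorm*`), i.e.
**`F · (q^{m−1}(q+1)) · (q^{(m−ℓ)−(j−2ℓ)} · q^{m−ℓ−1}(q+1))`**; with `F = q^m`, `j = 2m − N`, `2ℓ = M − N` this is Flicker's `(1 + q⁻¹)² q^{2m+N}` = ★ `iThirteen` (c)∕(e)
(ℚ-cast ★ `natCast_count_c_eq`).
* §1 `maximalIdeal_integer_eq_span` (`𝓂[K] = (ϖ)`, so `ϖ` is irreducible in `𝒪[K]`), the dictionary `v_norm_sub_le_iff_factor_eq` for `z = (aσa)⁻¹ + e + x`.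
* §2 **`natCard_cosets_of_iff_norm_sub_le`** — the coset count over `hce`.

## References
* [Flicker1998UnitaryFL] Y. Z. Flicker, *Elementary proof of the fundamental lemma for a unitary group*, Canad. J. Math. 50 (1998), 74–98: Prop. 13 pp. 91–93, Prop. 8 p. 84.
* [Rogawski1990] J. D. Rogawski, *Automorphic Representations of Unitary Groups in Three Variables* (1990), §4.9 p. 55.
-/

set_option autoImplicit false

open scoped MatrixGroups WithZero Valued
open Matrix

namespace Literature.NumberTheory.Automorphic

namespace UnitaryGroup

open Literature.NumberTheory.Automorphic.HermitianLattice (unitaryInt mem_unitaryInt_iff LocalConjDatum)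
open Literature.NumberTheory.LocalFields.UnramifiedQuadraticNorm IsLocalRing

variable {K : Type*} [Field K] [Valued K ℤᵐ⁰] {ϖ : K} (σ : K →+* K) {J : Matrix (Fin 3) (Fin 3) K}

/-! ## §1 `ϖ` is a uniformiser of `𝒪[K]`; the dictionary for the shifted norm condition -/

/-- **`𝓂[K] = (ϖ)` in `𝒪[K]`** when `|ϖ| = exp(−1)` (★ `mem_maximalIdeal_pow_iff_v_le` at `m = 1`: `|y| ≤ |ϖ|` iff `y = ϖ·(y∕ϖ)` with `y∕ϖ` integral).
[cite: Flicker1998UnitaryFL, Prop. 8 p. 84] -/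
theorem maximalIdeal_integer_eq_span (hϖ : Valued.v ϖ = WithZero.exp (-1 : ℤ)) :
    maximalIdeal 𝒪[K] = Ideal.span {(⟨ϖ, by show Valued.v ϖ ≤ 1; rw [hϖ, ← WithZero.exp_zero]; exact WithZero.exp_le_exp.2 (by norm_num)⟩ : 𝒪[K])} := by
  have hϖ0 : ϖ ≠ 0 := fun h => by rw [h, map_zero] at hϖ; exact WithZero.zero_ne_coe hϖ
  ext y
  rw [Ideal.mem_span_singleton, show maximalIdeal 𝒪[K] = 𝓂[K] ^ 1 from (pow_one _).symm, mem_maximalIdeal_pow_iff_v_le hϖ 1 y, pow_one]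
  constructor
  · intro hy
    have hq : Valued.v ((y : K) / ϖ) ≤ 1 := by
      rw [map_div₀]; exact div_le_one_of_le₀ hy zero_le
    refine ⟨⟨(y : K) / ϖ, hq⟩, Subtype.ext ?_⟩
    show (y : K) = ϖ * ((y : K) / ϖ)
    rw [mul_div_cancel₀ _ hϖ0]
  · rintro ⟨z, hz⟩
    have : (y : K) = ϖ * (z : K) := by rw [hz]; rfl
    rw [this, map_mul]
    exact mul_le_of_le_one_right zero_le z.2

/-- **`|N(z) − c| ≤ |ϖ^j| ↔ factor_j(Z̄ σ̄Z̄) = c̄ (mod 𝓂^j)`** for `z = (aσa)⁻¹ + e + x` (`|a| = 1`, `e`, `x` integral, `c ∈ 𝒪`), where on classes modulo `𝓂^m`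
`Z̄ = Ring.inverse (ā σ̄ā) + ē + x̄`. [cite: Flicker1998UnitaryFL, Prop. 13 p. 93] -/
theorem v_norm_sub_le_iff_factor_eq (hd : LocalConjDatum σ ϖ) (hσO : ∀ y : 𝒪[K], (σ.comp 𝒪[K].subtype) y ∈ 𝒪[K])
    {j m : ℕ} (hjm : j ≤ m) {a e x c : K} (ha : Valued.v a = 1) (he : Valued.v e ≤ 1) (hx : Valued.v x ≤ 1) (hc : Valued.v c ≤ 1) :
    Valued.v (((a * σ a)⁻¹ + e + x) * σ ((a * σ a)⁻¹ + e + x) - c) ≤ Valued.v (ϖ ^ j) ↔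
      Ideal.Quotient.factor (Ideal.pow_le_pow_right hjm)
        ((Ring.inverse (Ideal.Quotient.mk (𝓂[K] ^ m) ⟨a, ha.le⟩ *
              Ideal.quotientMap (𝓂[K] ^ m) ((σ.comp 𝒪[K].subtype).codRestrict 𝒪[K] hσO)
                (maximalIdeal_pow_le_comap_codRestrict σ hd.vϖ hd.vσ hσO m) (Ideal.Quotient.mk (𝓂[K] ^ m) ⟨a, ha.le⟩)) +
            Ideal.Quotient.mk (𝓂[K] ^ m) ⟨e, he⟩ + Ideal.Quotient.mk (𝓂[K] ^ m) ⟨x, hx⟩) *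
          Ideal.quotientMap (𝓂[K] ^ m) ((σ.comp 𝒪[K].subtype).codRestrict 𝒪[K] hσO)
            (maximalIdeal_pow_le_comap_codRestrict σ hd.vϖ hd.vσ hσO m)
            (Ring.inverse (Ideal.Quotient.mk (𝓂[K] ^ m) ⟨a, ha.le⟩ *
                Ideal.quotientMap (𝓂[K] ^ m) ((σ.comp 𝒪[K].subtype).codRestrict 𝒪[K] hσO)
                  (maximalIdeal_pow_le_comap_codRestrict σ hd.vϖ hd.vσ hσO m) (Ideal.Quotient.mk (𝓂[K] ^ m) ⟨a, ha.le⟩)) +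
              Ideal.Quotient.mk (𝓂[K] ^ m) ⟨e, he⟩ + Ideal.Quotient.mk (𝓂[K] ^ m) ⟨x, hx⟩)) =
        Ideal.Quotient.mk (𝓂[K] ^ j) ⟨c, hc⟩ := by
  have hσa : Valued.v (σ a) ≤ 1 := by rw [hd.vσ]; exact ha.le
  have hn1 : Valued.v (a * σ a) = 1 := by rw [map_mul, hd.vσ, ha, mul_one]
  have hn0 : a * σ a ≠ 0 := fun h => by rw [h, map_zero] at hn1; exact zero_ne_one hn1
  have hninv : Valued.v (a * σ a)⁻¹ ≤ 1 := by rw [map_inv₀, hn1, inv_one]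
  set σm := Ideal.quotientMap (𝓂[K] ^ m) ((σ.comp 𝒪[K].subtype).codRestrict 𝒪[K] hσO)
    (maximalIdeal_pow_le_comap_codRestrict σ hd.vϖ hd.vσ hσO m) with hσm
  have hσmk : ∀ (y : K) (hy : Valued.v y ≤ 1), σm (Ideal.Quotient.mk (𝓂[K] ^ m) ⟨y, hy⟩) =
      Ideal.Quotient.mk (𝓂[K] ^ m) ⟨σ y, by show Valued.v (σ y) ≤ 1; rw [hd.vσ]; exact hy⟩ := fun y hy => by
    rw [hσm, Ideal.quotientMap_mk]; rfl
  -- the inverse class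
  set nO : 𝒪[K] := ⟨a, ha.le⟩ * ⟨σ a, hσa⟩ with hnO
  set niO : 𝒪[K] := ⟨(a * σ a)⁻¹, hninv⟩ with hniO
  have hmul : Ideal.Quotient.mk (𝓂[K] ^ m) nO * Ideal.Quotient.mk (𝓂[K] ^ m) niO = 1 := by
    rw [← map_mul, ← map_one (Ideal.Quotient.mk (𝓂[K] ^ m))]
    congr 1
    apply Subtype.ext
    show (a * σ a) * (a * σ a)⁻¹ = 1
    exact mul_inv_cancel₀ hn0
  have hunit : IsUnit (Ideal.Quotient.mk (𝓂[K] ^ m) nO) := isUnit_iff_exists_inv.2 ⟨_, hmul⟩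
  have hinv : Ring.inverse (Ideal.Quotient.mk (𝓂[K] ^ m) ⟨a, ha.le⟩ * σm (Ideal.Quotient.mk (𝓂[K] ^ m) ⟨a, ha.le⟩)) =
      Ideal.Quotient.mk (𝓂[K] ^ m) niO := by
    rw [hσmk, ← map_mul, ← hnO, ← hunit.unit_spec, Ring.inverse_unit]
    exact Units.inv_eq_of_mul_eq_one_right (by rw [hunit.unit_spec]; exact hmul)
  -- the integral `z`
  set zO : 𝒪[K] := niO + ⟨e, he⟩ + ⟨x, hx⟩ with hzO
  have hzcoe : (zO : K) = (a * σ a)⁻¹ + e + x := rfl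
  have hZ : Ring.inverse (Ideal.Quotient.mk (𝓂[K] ^ m) ⟨a, ha.le⟩ * σm (Ideal.Quotient.mk (𝓂[K] ^ m) ⟨a, ha.le⟩)) +
      Ideal.Quotient.mk (𝓂[K] ^ m) ⟨e, he⟩ + Ideal.Quotient.mk (𝓂[K] ^ m) ⟨x, hx⟩ = Ideal.Quotient.mk (𝓂[K] ^ m) zO := by
    rw [hinv, hzO, map_add, map_add]
  have hcoe : ((zO * ((σ.comp 𝒪[K].subtype).codRestrict 𝒪[K] hσO) zO - ⟨c, hc⟩ : 𝒪[K]) : K) =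
      ((a * σ a)⁻¹ + e + x) * σ ((a * σ a)⁻¹ + e + x) - c := by
    rw [← hzcoe]; rfl
  rw [hZ, hσm, Ideal.quotientMap_mk, ← map_mul, Ideal.Quotient.factor_mk, Ideal.Quotient.eq, mem_maximalIdeal_pow_iff_v_le hd.vϖ, hcoe]

/-! ## §2 The coset count of cases (c)∕(e) over the CORE-0 criterion -/

section Count

variable [IsDiscreteValuationRing 𝒪[K]] [Finite (ResidueField 𝒪[K])] [IsAdicComplete (maximalIdeal 𝒪[K]) 𝒪[K]]

/-- **PROP. 13, CASES (c)∕(e), AS A COSET COUNT over the CORE-0 criterion.**  Let `τ ∈ U` and suppose that for every `p = p(u,x,w) ∈ P_H`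
**`p⁻¹ τ p ∈ H^K_m ↔ |N((uσu)⁻¹ + e + x) − (e² − 1)| ≤ |ϖ^j|`** (binder `hce`; `e` integral `σ`-fixed with `e² − 1 = ϖ^{2ℓ}γ`, `γ` a `σ`-fixed unit, `2ℓ < j ≤ m` —
CORE-0's criterion of the printed cases (c)∕(e), `j = 2m − N`, `2ℓ = M − N`).  Then, `F` denoting the common size of the fibres of `ρ_m` on the coset space (`hfib`),
`#{y ∈ P_H ⧸ (P_H ∩ H^K_m) : y⁻¹ τ y ∈ H^K_m} = F · (q^{m−1}(q+1)) · (q^{(m−ℓ)−(j−2ℓ)} · q^{m−ℓ−1}(q+1))` — Flicker's `(1+q⁻¹)² q^{2m+N}` at `F = q^m`.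
Route = ★ `natCard_cosets_regime_four`'s: count through `ρ_m`, range by ★ (H1)(H3), the pair count ★ `natCard_pairs_norm_congr_shift` at `R = 𝒪[K]`.
[cite: Flicker1998UnitaryFL, Prop. 13 p. 93; Prop. 8 p. 84] -/
theorem natCard_cosets_of_iff_norm_sub_le (hJ : J = (StdForm.antidiagonal 3).over K) (hd : LocalConjDatum σ ϖ)
    (hσO : ∀ y : 𝒪[K], (σ.comp 𝒪[K].subtype) y ∈ 𝒪[K]) {m j ℓ : ℕ} (hm : 1 ≤ m) (hj : 2 * ℓ < j) (hjm : j ≤ m)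
    {c um τ : ↥(unitaryGroupOfForm σ J)} (hc : ((c : GL (Fin 3) K) : Matrix (Fin 3) (Fin 3) K) = !![1, 0, 0; 0, -1, 0; 0, 0, 1])
    {e γ : K} (he : Valued.v e ≤ 1) (hσe : σ e = e) (hγ : Valued.v γ = 1) (hσγ : σ γ = γ) (hec : e ^ 2 - 1 = ϖ ^ (2 * ℓ) * γ)
    (hce : ∀ p ∈ flickerPH σ J c, ∀ u x w : K,
      ((p : GL (Fin 3) K) : Matrix (Fin 3) (Fin 3) K) = !![u, 0, u * x; 0, w, 0; 0, 0, (σ u)⁻¹] →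
        (p⁻¹ * τ * p ∈ flickerHK σ J c um ↔
          Valued.v (((u * σ u)⁻¹ + e + x) * σ ((u * σ u)⁻¹ + e + x) - (e ^ 2 - 1)) ≤ Valued.v (ϖ ^ j)))
    {q : ℕ} (hq : Nat.card (ResidueField 𝒪[K]) = q ^ 2)
    {a₀ : 𝒪[K]} (ha₀ : IsUnit (((σ.comp 𝒪[K].subtype).codRestrict 𝒪[K] hσO) a₀ - a₀))
    (hSN : flickerPH σ J c ⊓ flickerHK σ J c um ≤ flickerPH0 σ J c (ϖ ^ m))
    [Finite (↥(flickerPH σ J c) ⧸ (flickerHK σ J c um).subgroupOf (flickerPH σ J c))] {F : ℕ}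
    (hfib : ∀ z ∈ Set.range (fun w : ↥(flickerPH σ J c) ⧸ (flickerHK σ J c um).subgroupOf (flickerPH σ J c) =>
        flickerPHRho σ m ((Quotient.out w : ↥(flickerPH σ J c)) : ↥(unitaryGroupOfForm σ J))),
      Nat.card {w : ↥(flickerPH σ J c) ⧸ (flickerHK σ J c um).subgroupOf (flickerPH σ J c) //
        flickerPHRho σ m ((Quotient.out w : ↥(flickerPH σ J c)) : ↥(unitaryGroupOfForm σ J)) = z} = F) :
    Nat.card {w : ↥(flickerPH σ J c) ⧸ (flickerHK σ J c um).subgroupOf (flickerPH σ J c) //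
      ((Quotient.out w : ↥(flickerPH σ J c)) : ↥(unitaryGroupOfForm σ J))⁻¹ * τ * (Quotient.out w : ↥(flickerPH σ J c)) ∈ flickerHK σ J c um} =
      F * ((q ^ (m - 1) * (q + 1)) * (q ^ ((m - ℓ) - (j - 2 * ℓ)) * (q ^ ((m - ℓ) - 1) * (q + 1)))) := by
  classical
  have h2v : Valued.v (2 : K) = 1 := hd.v2
  -- the restricted involution and the data in `𝒪[K]`
  set σO : 𝒪[K] →+* 𝒪[K] := (σ.comp 𝒪[K].subtype).codRestrict 𝒪[K] hσO with hσOdef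
  have hσOσO : ∀ z, σO (σO z) = z := fun z => Subtype.ext (hd.σσ (z : K))
  have h2O : IsUnit (2 : 𝒪[K]) :=
    (Valuation.Integers.isUnit_iff_valuation_eq_one (Valuation.integer.integers _)).2 (by rw [map_ofNat]; exact h2v)
  have hϖle : Valued.v ϖ ≤ 1 := by rw [hd.vϖ, ← WithZero.exp_zero]; exact WithZero.exp_le_exp.2 (by norm_num)
  set pO : 𝒪[K] := ⟨ϖ, hϖle⟩ with hpO
  have hp : Irreducible pO := (IsDiscreteValuationRing.irreducible_iff_uniformizer pO).2 (maximalIdeal_integer_eq_span hd.vϖ)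
  have hσp : σO pO = pO := Subtype.ext (by show σ ϖ = ϖ; exact hd.σϖ)
  set eO : 𝒪[K] := ⟨e, he⟩ with heO
  have hσeO : σO eO = eO := Subtype.ext (by show σ e = e; exact hσe)
  set γO : 𝒪[K] := ⟨γ, hγ.le⟩ with hγO
  have hγOu : IsUnit γO := (Valuation.Integers.isUnit_iff_valuation_eq_one (Valuation.integer.integers _)).2 hγ
  have hσγO : σO γO = γO := Subtype.ext (by show σ γ = γ; exact hσγ)
  have hecO : eO ^ 2 - 1 = pO ^ (2 * ℓ) * γO := Subtype.ext (by simpa [heO, hpO, hγO] using hec)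
  have hcv : Valued.v (e ^ 2 - 1) ≤ 1 := by
    have h : ((eO ^ 2 - 1 : 𝒪[K]) : K) = e ^ 2 - 1 := by simp [heO]
    rw [← h]; exact (eO ^ 2 - 1).2
  -- the predicate counted by the pair count, and the map `f = ρ_m ∘ out`
  set P := flickerPH σ J c with hPdef
  set S := (flickerHK σ J c um).subgroupOf (flickerPH σ J c) with hSdef
  set f : ↥P ⧸ S → (𝒪[K] ⧸ 𝓂[K] ^ m) × (𝒪[K] ⧸ 𝓂[K] ^ m) :=
    fun w => flickerPHRho σ m ((Quotient.out w : ↥P) : ↥(unitaryGroupOfForm σ J)) with hfdef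
  set Q : (𝒪[K] ⧸ 𝓂[K] ^ m) × (𝒪[K] ⧸ 𝓂[K] ^ m) → Prop := fun ux =>
    IsUnit ux.1 ∧ Ideal.quotientMap (maximalIdeal 𝒪[K] ^ m) σO (maximalIdeal_pow_le_comap σO hσOσO m) ux.2 = -ux.2 ∧
      Ideal.Quotient.factor (Ideal.pow_le_pow_right hjm)
        ((Ring.inverse (ux.1 * Ideal.quotientMap (maximalIdeal 𝒪[K] ^ m) σO (maximalIdeal_pow_le_comap σO hσOσO m) ux.1) +
            Ideal.Quotient.mk (maximalIdeal 𝒪[K] ^ m) eO + ux.2) *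
          Ideal.quotientMap (maximalIdeal 𝒪[K] ^ m) σO (maximalIdeal_pow_le_comap σO hσOσO m)
            (Ring.inverse (ux.1 * Ideal.quotientMap (maximalIdeal 𝒪[K] ^ m) σO (maximalIdeal_pow_le_comap σO hσOσO m) ux.1) +
              Ideal.Quotient.mk (maximalIdeal 𝒪[K] ^ m) eO + ux.2)) =
        Ideal.Quotient.mk (maximalIdeal 𝒪[K] ^ j) (pO ^ (2 * ℓ) * γO) with hQdef
  have hσbar : Ideal.quotientMap (maximalIdeal 𝒪[K] ^ m) σO (maximalIdeal_pow_le_comap σO hσOσO m) =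
      Ideal.quotientMap (𝓂[K] ^ m) ((σ.comp 𝒪[K].subtype).codRestrict 𝒪[K] hσO) (maximalIdeal_pow_le_comap_codRestrict σ hd.vϖ hd.vσ hσO m) := rfl
  have hcO : (⟨e ^ 2 - 1, hcv⟩ : 𝒪[K]) = pO ^ (2 * ℓ) * γO := by rw [← hecO]; exact Subtype.ext (by simp [heO])
  -- Step A: «good» ⟺ `Q ∘ f`
  have stepA : ∀ w : ↥P ⧸ S, ((Quotient.out w : ↥P) : ↥(unitaryGroupOfForm σ J))⁻¹ * τ * (Quotient.out w : ↥P) ∈ flickerHK σ J c um ↔ Q (f w) := by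
    intro w
    set pp : ↥(unitaryGroupOfForm σ J) := ((Quotient.out w : ↥P) : ↥(unitaryGroupOfForm σ J)) with hpp
    have hpP : pp ∈ flickerPH σ J c := (Quotient.out w).2
    obtain ⟨u, x, wc, hpm, hvu, hvx, hσx, hvw, hσw⟩ := exists_coe_eq_borel_of_mem_flickerPH σ hJ hd hc hpP
    have hu0 : u ≠ 0 := fun h => by rw [h, map_zero] at hvu; exact zero_ne_one hvu
    have hw0 : wc ≠ 0 := fun h => by rw [h, map_zero] at hvw; exact zero_ne_one hvw
    have hva : Valued.v (u * wc⁻¹) = 1 := by rw [map_mul, map_inv₀, hvu, hvw, inv_one, one_mul]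
    have hρ : f w = (Ideal.Quotient.mk (𝓂[K] ^ m) ⟨u * wc⁻¹, hva.le⟩, Ideal.Quotient.mk (𝓂[K] ^ m) ⟨x, hvx⟩) := by
      show flickerPHRho σ m pp = _
      rw [flickerPHRho_of_coe_eq σ m hpm hu0, toQuotPow_of_le m hva.le, toQuotPow_of_le m hvx]
    have hQ1 : Ideal.quotientMap (maximalIdeal 𝒪[K] ^ m) σO (maximalIdeal_pow_le_comap σO hσOσO m) (f w).2 = -(f w).2 := by
      rw [hσbar]; exact quotientMap_flickerPHRho_snd σ hJ hd hσO hc m hpP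
    have hQ2 : IsUnit (f w).1 := isUnit_flickerPHRho_fst σ hJ hd hc m hpP
    rw [hce pp hpP u x wc hpm]
    -- rewrite `uσu = N(u w⁻¹)`
    have hσwc : σ wc = wc⁻¹ := eq_inv_of_mul_eq_one_left hσw
    have hN : u * σ u = (u * wc⁻¹) * σ (u * wc⁻¹) := by
      rw [map_mul, map_inv₀, hσwc, inv_inv]; field_simp
    rw [hN, v_norm_sub_le_iff_factor_eq σ hd hσO hjm hva he hvx hcv, hcO]
    rw [hρ] at hQ1 hQ2
    rw [hQdef, hρ]
    exact ⟨fun h => ⟨hQ2, hQ1, h⟩, fun h => h.2.2⟩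
  -- Step B: count through `f`
  rw [Nat.card_congr (Equiv.subtypeEquivRight stepA), natCard_subtype_comp_eq_mul f Q F hfib]
  congr 1
  -- Step C: the range condition is implied by `Q` (★ (H3) surjectivity + (H1) + `S ≤ N₀`)
  have stepC : ∀ z, Q z → z ∈ Set.range f := by
    rintro ⟨α, β⟩ ⟨hα, hβ, -⟩
    obtain ⟨a, rfl⟩ := Ideal.Quotient.mk_surjective α
    obtain ⟨bb, rfl⟩ := Ideal.Quotient.mk_surjective β
    have hau : IsUnit a := isUnit_of_isUnit_mk_pow (R := 𝒪[K]) hm hα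
    have hav : Valued.v (a : K) = 1 := (Valuation.Integers.isUnit_iff_valuation_eq_one (Valuation.integer.integers _)).1 hau
    rw [hσbar] at hβ
    obtain ⟨pp, hpp, hρ⟩ := exists_mem_flickerPH_flickerPHRho_eq σ hJ hd hσO hc m a bb hav hβ
    refine ⟨QuotientGroup.mk ⟨pp, hpp⟩, ?_⟩
    obtain ⟨s, hs'⟩ := QuotientGroup.mk_out_eq_mul S (⟨pp, hpp⟩ : ↥P)
    show flickerPHRho σ m ((Quotient.out (QuotientGroup.mk (⟨pp, hpp⟩ : ↥P) : ↥P ⧸ S) : ↥P) : ↥(unitaryGroupOfForm σ J)) = _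
    rw [hs', Subgroup.coe_mul, ← hρ]
    symm
    rw [flickerPHRho_eq_iff σ hJ hd hc m hpp (Subgroup.mul_mem _ hpp (s : ↥P).2), ← mul_assoc, inv_mul_cancel, one_mul]
    exact hSN ⟨(s : ↥P).2, s.2⟩
  rw [Nat.card_congr (Equiv.subtypeEquivRight fun z => (and_iff_right_of_imp (stepC z) : z ∈ Set.range f ∧ Q z ↔ Q z))]
  -- Step D: the pair count at `R = 𝒪[K]`
  exact natCard_pairs_norm_congr_shift σO hσOσO ha₀ hq h2O hp hσp hm hj hjm hσeO hγOu hσγO hecO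

end Count

end UnitaryGroup

end Literature.NumberTheory.Automorphic
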